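import Mathlib
import Summits.KontsevichZagierPeriods.Zeta5Search.Families.DualExactTwelve
import Summits.KontsevichZagierPeriods.Zeta5Search.Families.DualQBridge
import Summits.KontsevichZagierPeriods.Zeta5Search.Families.DualConstantTerm
import HarnessLib

/-!
# ζ(5) search — Families: the extended dual constant term `Φ` IS the dual constant term on Brown–Zudilin's family, and
# CONJECTURE D-exact follows from the base identity

HONEST FRAMING: systematic search; no irrationality claim unless certified.  Cell `pub-zeta5`, certifier 2
(cert-2 g8, 2026-08-22).  Identities between integer polynomial / power-series coefficients; the only non-proved input
is cert-2 g8's `DualBaseIdentity` (`Families/DualExactTwelve`, `@[conjecture]`, used as a HYPOTHESIS of the last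
theorem); nothing about `ζ(5)`; no number of record moves.

WHAT.
* The monomial substitution `θ : g_w ↦ h·r₁⋯r_w` (`theta`; `h = image of g₀`, `r_i = X i`) of the gap ring
  `ℤ[g₀,…,g₅]` preserves coefficients (`coeff_theta`: `[x^{θ̂ m}] θ(P) = [g^m] P`, `θ̂` injective on exponents) and maps
  each span `L_S` to `θ(g_{min S}) · u_S(r)` (`theta_spanPoly`); hence **`Phi_eq_coeff`**: on the region
  `nExp e t ≥ 0`, `B(e,t) ≥ 0` the extended dual constant term `Φ(e,t)` of `Families/DualExactTwelve` IS the honest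
  coefficient `[g^{B(e,t)}] ∏_S L_S^{n_S(e,t)}` (`tenProd`).
* On Brown–Zudilin's family (`e(a), t(a)` of `Families/DualQBridge`): `nExp = (0, A₇, A₆, A₀, A₁, 0, A₃, A₂, 0, 0)` and
  `B = (B₀,…,B₅)` (`A = bzNum a`, `B = bzDen a`), so **`Phi_eq_dualConstantTerm : Φ(e(a),t(a)) = dualConstantTerm a`**.
* **`dexact_of_base : DualBaseIdentity → (bzNum a ≥ 0 → bzDen a ≥ 0 → h₂₇(a) ≥ 0 → |Q(a)| = dualConstantTerm a)`** —
  P2 g6's CONJECTURE D-exact (`LeadingCoeffIsDualConstantTerm`) on the half-space `h₂₇ ≥ 0` (which contains the whole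
  convergent cone) REDUCED to the 5-parameter base identity: composition of `DualQ.abs_QOf_eq_G` (p313389),
  `DualR.G_eq_Phi_of_base` (p313599) and the bridge above.
-/

noncomputable section

open MvPolynomial Finset

namespace Summit.KontsevichZagierPeriods.Zeta5Search.Families.Cellular

namespace DualR

open Literature.NumberTheory.Irrationality
open Literature.NumberTheory.Irrationality.BrownZudilin2022 (QOf)

/-- The gap polynomial ring `ℤ[g₀,…,g₅]` (also read as `ℤ[h, r₁,…,r₅]` on the target side of `θ`). -/
abbrev G6 := MvPolynomial (Fin 6) ℤ

/-! ## The monomial substitution `θ` -/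

/-- `θ(g_w) = h·r₁⋯r_w` (indices: `X 0 = h`, `X i = r_i`). -/
def gImg : Fin 6 → G6 :=
  ![X 0, X 0 * X 1, X 0 * X 1 * X 2, X 0 * X 1 * X 2 * X 3, X 0 * X 1 * X 2 * X 3 * X 4,
    X 0 * X 1 * X 2 * X 3 * X 4 * X 5]

/-- The substitution `θ` as an algebra map. -/
def theta : G6 →ₐ[ℤ] G6 := MvPolynomial.aeval gImg

/-- `θ` on exponent vectors: `θ̂(m)_i = Σ_{w ≥ i} m_w`. -/
def thetaHat (m : Fin 6 →₀ ℕ) : Fin 6 →₀ ℕ :=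
  Finsupp.equivFunOnFinite.symm ![m 0 + m 1 + m 2 + m 3 + m 4 + m 5, m 1 + m 2 + m 3 + m 4 + m 5,
    m 2 + m 3 + m 4 + m 5, m 3 + m 4 + m 5, m 4 + m 5, m 5]

/-- `θ` maps monomials to monomials: `θ(c·g^m) = c·x^{θ̂ m}`. -/
theorem theta_monomial (m : Fin 6 →₀ ℕ) (c : ℤ) : theta (monomial m c) = monomial (thetaHat m) c := by
  unfold theta
  rw [aeval_monomial, monomial_eq, MvPolynomial.algebraMap_eq, Finsupp.prod_fintype _ _ (fun i => by simp),
    Finsupp.prod_fintype _ _ (fun i => by simp)]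
  simp only [Fin.prod_univ_six, gImg, thetaHat, Finsupp.coe_equivFunOnFinite_symm, Matrix.cons_val_zero,
    Matrix.cons_val_one, Matrix.cons_val]
  ring

/-- `θ̂` is injective. -/
theorem thetaHat_injective : Function.Injective thetaHat := by
  intro m m' h
  have h' : ∀ i, thetaHat m i = thetaHat m' i := fun i => by rw [h]
  have h0 := h' 0; have h1 := h' 1; have h2 := h' 2; have h3 := h' 3; have h4 := h' 4; have h5 := h' 5
  simp only [thetaHat, Finsupp.coe_equivFunOnFinite_symm, Matrix.cons_val_zero, Matrix.cons_val_one,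
    Matrix.cons_val] at h0 h1 h2 h3 h4 h5
  ext i; fin_cases i <;> simp <;> omega

/-- **`θ` preserves coefficients**: `[x^{θ̂ m}] θ(P) = [g^m] P`. -/
theorem coeff_theta (P : G6) (m : Fin 6 →₀ ℕ) : coeff (thetaHat m) (theta P) = coeff m P := by
  classical
  induction P using MvPolynomial.induction_on' with
  | monomial u r =>
    rw [theta_monomial, coeff_monomial, coeff_monomial]
    simp only [thetaHat_injective.eq_iff]
  | add p q hp hq => simp only [map_add, coeff_add, hp, hq]

/-! ## The ten spans and their images -/

/-- The ten spans as polynomials in the gaps (order `01, 012, 0123, 12, 12345, 23, 234, 2345, 45, 012345`). -/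
def spanPoly : Fin 10 → G6 :=
  ![X 0 + X 1, X 0 + X 1 + X 2, X 0 + X 1 + X 2 + X 3, X 1 + X 2, X 1 + X 2 + X 3 + X 4 + X 5, X 2 + X 3,
    X 2 + X 3 + X 4, X 2 + X 3 + X 4 + X 5, X 4 + X 5, X 0 + X 1 + X 2 + X 3 + X 4 + X 5]

/-- The product `∏_S L_S^{n_S}` for `n ∈ ℕ¹⁰`. -/
def tenProd (n : Fin 10 → ℕ) : G6 := ∏ k, spanPoly k ^ n k

/-- Polynomial twins of the span units `uPoly` of `Families/DualGapSeries` (variables `r₁..r₅ = X 0..X 4`). -/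
def uPolyQ : Fin 10 → MvPolynomial (Fin 5) ℤ :=
  ![1 + X 0, 1 + X 0 + X 0 * X 1, 1 + X 0 + X 0 * X 1 + X 0 * X 1 * X 2, 1 + X 1,
    1 + X 1 + X 1 * X 2 + X 1 * X 2 * X 3 + X 1 * X 2 * X 3 * X 4, 1 + X 2, 1 + X 2 + X 2 * X 3,
    1 + X 2 + X 2 * X 3 + X 2 * X 3 * X 4, 1 + X 4,
    1 + X 0 + X 0 * X 1 + X 0 * X 1 * X 2 + X 0 * X 1 * X 2 * X 3 + X 0 * X 1 * X 2 * X 3 * X 4]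

/-- The polynomial twin coerces to the power-series unit. -/
theorem coe_uPolyQ (k : Fin 10) : ((uPolyQ k : MvPolynomial (Fin 5) ℤ) : S5) = uPoly k := by
  fin_cases k <;> simp [uPolyQ, uPoly, r, MvPolynomial.coe_X]

/-- The product of polynomial twins `∏ uPolyQ_S^{n_S}`. -/
def tenProdQ (n : Fin 10 → ℕ) : MvPolynomial (Fin 5) ℤ := ∏ k, uPolyQ k ^ n k

/-- For non-negative exponents, `E(n)` is the coercion of the polynomial product. -/
theorem E_val_eq_coe (n : Fin 10 → ℕ) : ((E (fun k => (n k : ℤ)) : S5ˣ) : S5) = (tenProdQ n : S5) := by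
  unfold E tenProdQ
  rw [Units.coe_prod, ← MvPolynomial.coeToMvPowerSeries.ringHom_apply, map_prod]
  refine Finset.prod_congr rfl fun k _ => ?_
  rw [zpow_natCast, Units.val_pow_eq_pow_val, val_uUnit, map_pow, MvPolynomial.coeToMvPowerSeries.ringHom_apply,
    coe_uPolyQ]

/-- The leading gap `min S` of each span. -/
def leadIdx : Fin 10 → Fin 6 := ![0, 0, 0, 1, 1, 2, 2, 2, 4, 0]

/-- `θ(L_S) = θ(g_{min S}) · u_S(r)` with `u_S` renamed into `X 1..X 5`. -/
theorem theta_spanPoly (k : Fin 10) :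
    theta (spanPoly k) = gImg (leadIdx k) * rename Fin.succ (uPolyQ k) := by
  unfold theta
  fin_cases k <;> simp [spanPoly, gImg, leadIdx, uPolyQ, Fin.succ] <;> ring

/-- The monomial part of `θ(∏ L_S^{n_S})`: `M(n) = Σ_S n_S • θ̂(e_{min S})` as an exponent vector. -/
def monoExp (n : Fin 10 → ℕ) : Fin 6 →₀ ℕ :=
  Finsupp.equivFunOnFinite.symm
    ![n 0 + n 1 + n 2 + n 3 + n 4 + n 5 + n 6 + n 7 + n 8 + n 9, n 3 + n 4 + n 5 + n 6 + n 7 + n 8,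
      n 5 + n 6 + n 7 + n 8, n 8, n 8, 0]

/-- `θ(∏ L_S^{n_S}) = x^{M(n)} · rename(∏ u_S^{n_S})`. -/
theorem theta_tenProd (n : Fin 10 → ℕ) :
    theta (tenProd n) = monomial (monoExp n) 1 * rename Fin.succ (tenProdQ n) := by
  unfold tenProd tenProdQ
  rw [map_prod, map_prod]
  simp only [map_pow, theta_spanPoly, mul_pow, Finset.prod_mul_distrib]
  congr 1
  rw [monomial_eq, C_1, one_mul, Finsupp.prod_fintype _ _ (fun i => by simp)]
  simp only [Fin.prod_univ_succ, Fin.prod_univ_zero, monoExp, Finsupp.coe_equivFunOnFinite_symm]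
  simp [gImg, leadIdx, Fin.succ]
  ring

/-! ## The bridge `Φ = [g^B] ∏ L^n` on the region `n ≥ 0`, `B ≥ 0` -/

/-- The six gap exponents `B(e,t) = (e₅+e₇−t₅, t₅, e₃+e₇−t₂, t₂, e₄+e₆−t₄, t₄)`. -/
def Bvec (e : Fin 7 → ℕ) (t : Fin 5 → ℤ) : Fin 6 → ℤ :=
  ![(e 4 : ℤ) + e 6 - t 4, t 4, (e 2 : ℤ) + e 6 - t 1, t 1, (e 3 : ℤ) + e 5 - t 3, t 3]

/-- **`Φ(e,t) = [g^{B(e,t)}] ∏_S L_S^{n_S(e,t)}`** whenever all ten span exponents and all six gap exponents are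
non-negative. -/
theorem Phi_eq_coeff (e : Fin 7 → ℕ) (t : Fin 5 → ℤ) (hn : ∀ k, 0 ≤ nExp e t k) (hB : ∀ w, 0 ≤ Bvec e t w) :
    Phi e t = coeff (Finsupp.equivFunOnFinite.symm fun w => (Bvec e t w).toNat)
      (tenProd fun k => (nExp e t k).toNat) := by
  have en : ∀ k, (((nExp e t k).toNat : ℕ) : ℤ) = nExp e t k := fun k => Int.toNat_of_nonneg (hn k)
  have eb : ∀ w, (((Bvec e t w).toNat : ℕ) : ℤ) = Bvec e t w := fun w => Int.toNat_of_nonneg (hB w)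
  have hE : ((E (nExp e t) : S5ˣ) : S5) = (tenProdQ (fun k => (nExp e t k).toNat) : S5) := by
    have hnE : nExp e t = fun k => (((nExp e t k).toNat : ℕ) : ℤ) := by funext k; rw [en k]
    conv_lhs => rw [hnE]
    exact E_val_eq_coe _
  -- the component identity behind the bookkeeping: `θ̂(B) = M(n) + (0, c)` whenever `c ≥ 0`
  have comp : (∀ j, 0 ≤ cExp e t j) → ∀ i : Fin 6,
      thetaHat (Finsupp.equivFunOnFinite.symm fun w => (Bvec e t w).toNat) i =
        monoExp (fun k => (nExp e t k).toNat) i +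
          (Finsupp.mapDomain Fin.succ (Finsupp.equivFunOnFinite.symm fun j => (cExp e t j).toNat) : Fin 6 →₀ ℕ) i := by
    intro hc i
    have ec : ∀ j, (((cExp e t j).toNat : ℕ) : ℤ) = cExp e t j := fun j => Int.toNat_of_nonneg (hc j)
    have hsucc : ∀ j : Fin 5, (Finsupp.mapDomain Fin.succ
        (Finsupp.equivFunOnFinite.symm fun j => (cExp e t j).toNat) : Fin 6 →₀ ℕ) (Fin.succ j) = (cExp e t j).toNat :=
      fun j => by rw [Finsupp.mapDomain_apply (Fin.succ_injective _), Finsupp.coe_equivFunOnFinite_symm]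
    fin_cases i
    · have h0 : (0 : Fin 6) ∉ Set.range (Fin.succ : Fin 5 → Fin 6) := by simp
      rw [show (⟨0, by norm_num⟩ : Fin 6) = 0 from rfl, Finsupp.mapDomain_notin_range (f := Fin.succ) _ 0 h0]
      simp only [thetaHat, monoExp, Finsupp.coe_equivFunOnFinite_symm, Matrix.cons_val_zero, add_zero]
      zify
      simp only [en, eb]
      simp only [nExp, Bvec, Matrix.cons_val_zero, Matrix.cons_val_one, Matrix.cons_val]
      omega
    · rw [show (⟨1, by norm_num⟩ : Fin 6) = Fin.succ 0 from rfl, hsucc]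
      simp only [thetaHat, monoExp, Finsupp.coe_equivFunOnFinite_symm, Fin.succ_zero_eq_one, Matrix.cons_val_one,
        Matrix.cons_val_zero]
      zify
      simp only [en, eb, ec]
      simp only [nExp, Bvec, cExp, Matrix.cons_val_zero, Matrix.cons_val_one, Matrix.cons_val]
      omega
    · rw [show (⟨2, by norm_num⟩ : Fin 6) = Fin.succ 1 from rfl, hsucc]
      simp only [thetaHat, monoExp, Finsupp.coe_equivFunOnFinite_symm, Fin.succ_one_eq_two, Matrix.cons_val]
      zify
      simp only [en, eb, ec]
      simp only [nExp, Bvec, cExp, Matrix.cons_val_one, Matrix.cons_val]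
      omega
    · rw [show (⟨3, by norm_num⟩ : Fin 6) = Fin.succ 2 from rfl, hsucc]
      simp only [thetaHat, monoExp, Finsupp.coe_equivFunOnFinite_symm, Matrix.cons_val_succ, Matrix.cons_val]
      zify
      simp only [en, eb, ec]
      simp only [nExp, Bvec, cExp, Matrix.cons_val]
      omega
    · rw [show (⟨4, by norm_num⟩ : Fin 6) = Fin.succ 3 from rfl, hsucc]
      simp only [thetaHat, monoExp, Finsupp.coe_equivFunOnFinite_symm, Matrix.cons_val_succ, Matrix.cons_val]
      zify
      simp only [en, eb, ec]
      simp only [nExp, Bvec, cExp, Matrix.cons_val]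
      omega
    · rw [show (⟨5, by norm_num⟩ : Fin 6) = Fin.succ 4 from rfl, hsucc]
      simp only [thetaHat, monoExp, Finsupp.coe_equivFunOnFinite_symm, Matrix.cons_val_succ, Matrix.cons_val, zero_add]
      zify
      simp only [eb, ec]
      simp only [Bvec, cExp, Matrix.cons_val]
  rw [← coeff_theta, theta_tenProd, coeff_monomial_mul']
  unfold Phi coeffZ
  by_cases hc : ∀ j, 0 ≤ cExp e t j
  · have hle : monoExp (fun k => (nExp e t k).toNat) ≤
        thetaHat (Finsupp.equivFunOnFinite.symm fun w => (Bvec e t w).toNat) :=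
      Finsupp.le_def.2 fun i => by rw [comp hc i]; exact Nat.le_add_right _ _
    have hidx : thetaHat (Finsupp.equivFunOnFinite.symm fun w => (Bvec e t w).toNat) -
        monoExp (fun k => (nExp e t k).toNat) =
        Finsupp.mapDomain Fin.succ (Finsupp.equivFunOnFinite.symm fun j => (cExp e t j).toNat) := by
      ext i; rw [Finsupp.tsub_apply, comp hc i, add_tsub_cancel_left]
    rw [if_pos hc, if_pos hle, one_mul, hidx, coeff_rename_mapDomain _ (Fin.succ_injective _), hE,
      MvPolynomial.coeff_coe]
  · rw [if_neg hc]
    by_cases hle : monoExp (fun k => (nExp e t k).toNat) ≤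
        thetaHat (Finsupp.equivFunOnFinite.symm fun w => (Bvec e t w).toNat)
    · exfalso
      apply hc
      have hle' := Finsupp.le_def.1 hle
      have h1 := hle' 1; have h2 := hle' 2; have h3 := hle' 3; have h4 := hle' 4; have h5 := hle' 5
      simp only [thetaHat, monoExp, Finsupp.coe_equivFunOnFinite_symm, Matrix.cons_val_zero, Matrix.cons_val_one,
        Matrix.cons_val] at h1 h2 h3 h4 h5
      zify at h1 h2 h3 h4 h5
      simp only [en, eb] at h1 h2 h3 h4 h5
      simp only [nExp, Bvec, Matrix.cons_val_zero, Matrix.cons_val_one, Matrix.cons_val] at h1 h2 h3 h4 h5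
      intro j
      fin_cases j
      · rw [show (⟨0, by norm_num⟩ : Fin 5) = 0 from rfl]; simp only [cExp, Matrix.cons_val_zero]; omega
      · rw [show (⟨1, by norm_num⟩ : Fin 5) = 1 from rfl]; simp only [cExp, Matrix.cons_val_one, Matrix.cons_val_zero]
        omega
      · rw [show (⟨2, by norm_num⟩ : Fin 5) = 2 from rfl]; simp only [cExp, Matrix.cons_val]; omega
      · rw [show (⟨3, by norm_num⟩ : Fin 5) = 3 from rfl]; simp only [cExp, Matrix.cons_val]; omega
      · rw [show (⟨4, by norm_num⟩ : Fin 5) = 4 from rfl]; simp only [cExp, Matrix.cons_val]; omega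
    · rw [if_neg hle]

/-- **The 12-parameter form of CONJECTURE D-exact, modulo the base identity**: for admissible `(p;q)` whose ten
span exponents and six gap exponents are non-negative, Brown–Zudilin's `|Q(p;q)|` is the honest coefficient
`[g^{B}] ∏_S L_S^{n_S}` of the ten-span product (four more spans than on Brown–Zudilin's own 8-parameter family). -/
theorem dexact12_of_base (hBI : DualBaseIdentity) (p : Fin 7 → ℤ) (q : Fin 5 → ℤ) (hp2 : 0 ≤ p 2) (hp4 : 0 ≤ p 4)
    (hq : ∀ j, 0 ≤ q j) (he1 : 0 ≤ q 2 - p 0 - p 6 + p 2 + p 4)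
    (hn : ∀ k, 0 ≤ nExp (DualQ.eOfPQ p q) (DualQ.tOfPQ p q) k) (hB : ∀ w, 0 ≤ Bvec (DualQ.eOfPQ p q) (DualQ.tOfPQ p q) w) :
    |BrownZudilin2022.Qcoeff p q| =
      coeff (Finsupp.equivFunOnFinite.symm fun w => (Bvec (DualQ.eOfPQ p q) (DualQ.tOfPQ p q) w).toNat)
        (tenProd fun k => (nExp (DualQ.eOfPQ p q) (DualQ.tOfPQ p q) k).toNat) := by
  rw [DualQ.abs_Qcoeff_eq_G p q hp2 hp4 hq he1, G_eq_Phi_of_base hBI, Phi_eq_coeff _ _ hn hB]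

/-! ## Brown–Zudilin's family -/

open DualQ (eOfA tOfA)

/-- On Brown–Zudilin's family the ten span exponents are `(0, A₇, A₆, A₀, A₁, 0, A₃, A₂, 0, 0)`. -/
theorem nExp_eOfA (a : Fin 8 → ℤ) (hA : ∀ i, 0 ≤ bzNum a i) (h27 : 0 ≤ a 3 + a 6 + 2 * a 7 - a 1 - a 2 - a 5) :
    nExp (eOfA a) (tOfA a) = ![0, a 6, a 0 + a 4 - a 2, a 0, a 1, 0, a 3, a 2, 0, 0] := by
  have a0 := hA 0; have a1 := hA 1; have a2 := hA 2; have a3 := hA 3; have a4 := hA 4; have a5 := hA 5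
  have a6 := hA 6; have a7 := hA 7
  simp [bzNum] at a0 a1 a2 a3 a4 a5 a6 a7
  funext k
  fin_cases k <;> simp [nExp, eOfA, tOfA] <;> omega

/-- On Brown–Zudilin's family the six gap exponents are `(B₀,…,B₅)`. -/
theorem Bvec_eOfA (a : Fin 8 → ℤ) (hA : ∀ i, 0 ≤ bzNum a i) :
    Bvec (eOfA a) (tOfA a) = fun w => bzDen a (Fin.castLE (by norm_num) w) := by
  have a0 := hA 0; have a1 := hA 1; have a2 := hA 2; have a3 := hA 3; have a4 := hA 4; have a5 := hA 5
  have a6 := hA 6; have a7 := hA 7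
  simp [bzNum] at a0 a1 a2 a3 a4 a5 a6 a7
  funext w
  fin_cases w <;> simp [Bvec, eOfA, tOfA, bzDen, BrownZudilin2022.b24, BrownZudilin2022.b14, BrownZudilin2022.b57,
    BrownZudilin2022.b35] <;> omega

/-- `dualSpanProd A` is the ten-span product with the four extra spans switched off. -/
theorem dualSpanProd_eq_tenProd (A : Fin 8 → ℕ) :
    dualSpanProd A = tenProd ![0, A 7, A 6, A 0, A 1, 0, A 3, A 2, 0, 0] := by
  unfold dualSpanProd tenProd
  simp [Fin.prod_univ_succ, spanPoly]
  ring

/-- **`Φ(e(a), t(a)) = dualConstantTerm a`** on the cone `bzNum a ≥ 0`, `bzDen a ≥ 0`, `h₂₇(a) ≥ 0`. -/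
theorem Phi_eq_dualConstantTerm (a : Fin 8 → ℤ) (hA : ∀ i, 0 ≤ bzNum a i) (hB : ∀ i, 0 ≤ bzDen a i)
    (h27 : 0 ≤ a 3 + a 6 + 2 * a 7 - a 1 - a 2 - a 5) : Phi (eOfA a) (tOfA a) = dualConstantTerm a := by
  have a0 := hA 0; have a1 := hA 1; have a2 := hA 2; have a3 := hA 3; have a6 := hA 6; have a7 := hA 7
  simp [bzNum] at a0 a1 a2 a3 a6 a7
  have hn : ∀ k, 0 ≤ nExp (eOfA a) (tOfA a) k := by
    intro k; rw [nExp_eOfA a hA h27]; fin_cases k <;> simp <;> omega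
  have hBv : ∀ w, 0 ≤ Bvec (eOfA a) (tOfA a) w := by
    intro w; rw [Bvec_eOfA a hA]; exact hB _
  have e1 : (Finsupp.equivFunOnFinite.symm fun w => (Bvec (eOfA a) (tOfA a) w).toNat) =
      Finsupp.equivFunOnFinite.symm fun w : Fin 6 => (bzDen a (Fin.castLE (by norm_num) w)).toNat := by
    rw [Bvec_eOfA a hA]
  have e2 : (fun k => (nExp (eOfA a) (tOfA a) k).toNat) = ![0, (bzNum a 7).toNat, (bzNum a 6).toNat,
      (bzNum a 0).toNat, (bzNum a 1).toNat, 0, (bzNum a 3).toNat, (bzNum a 2).toNat, 0, 0] := by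
    funext k; rw [nExp_eOfA a hA h27]; fin_cases k <;> simp [bzNum]
  rw [Phi_eq_coeff _ _ hn hBv, e1, e2]
  unfold dualConstantTerm
  rw [dualSpanProd_eq_tenProd]

/-- **CONJECTURE D-exact from the base identity.**  If `DualBaseIdentity` holds then for every `a ∈ ℤ⁸` with
`bzNum a ≥ 0`, `bzDen a ≥ 0` and `h₂₇(a) = a₃+a₆+2a₇−a₁−a₂−a₅ ≥ 0` (0-based), Brown–Zudilin's leading coefficient satisfies
`|Q(a)| = dualConstantTerm a`. -/
theorem dexact_of_base (hBI : DualBaseIdentity) (a : Fin 8 → ℤ) (hA : ∀ i, 0 ≤ bzNum a i)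
    (hB : ∀ i, 0 ≤ bzDen a i) (h27 : 0 ≤ a 3 + a 6 + 2 * a 7 - a 1 - a 2 - a 5) :
    |QOf a| = dualConstantTerm a := by
  rw [DualQ.abs_QOf_eq_G a hA h27, G_eq_Phi_of_base hBI, Phi_eq_dualConstantTerm a hA hB h27]

end DualR

end Summit.KontsevichZagierPeriods.Zeta5Search.Families.Cellular
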